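import Summits.FinalStateConjecture.FinalStateConjecture.Theorems.SwallowTheDatumParametricKerrBurialCollarLine
import Literature.Geometry.Lorentzian.InitialDataDilation
import HarnessLib

/-!
# Stub `stub_socketDilation` of the line `Sketch` (crux `SwallowTheDatum.UniversalWitnessFamily`,
# item stmt-FinalStateConjecture-10051): the dilates of a socket bag are socket bags

The DILATION stub of the line `Sketch` (skeleton `Cruxes/UniversalWitnessFamily/Lines/Sketch.lean`,
v5). Its `d`-free input is a SOCKET BAG `C` on `E3`: a vacuum constraint solution outside the unit
ball (`VacuumOn {1 < ‖y‖} C`), exactly time-symmetric isotropic Schwarzschild(`μ`),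
`((1 + μ/2‖y‖)⁴ δ, 0)`, on the annulus `{1 < ‖y‖ < 2}` (`IsSchwarzschildAnnulus C μ`), and exactly
time-symmetric isotropic Schwarzschild(`M`) on the open exterior sheet `{‖y‖ > M/2}`, `M > 4`
(`IsIsotropicBeyond M (M/2) C`). The DILATES
`C_l := C.dilate l = ((y ↦ y/l)^* C).homothety l` (`InitialDataDilation.lean`; Cartesian components
`h_l(y) = h(y/l)`, `k_l(y) = l⁻¹ k(y/l)`), `l > 0`, form a family (`C.dilateFamily`, junk value `C`
for `l ≤ 0`, never evaluated there) with sections jointly smooth on `{0 < l} × E3`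
(`SmoothSectionsOn`, the tree's `contMDiffAt_dilateFamily_h/_k`) all of whose members are socket bags
at scale `l`:
* vacuum on `{l < ‖y‖}`: diffeomorphism equivariance and homothety covariance of the constraint
  map (`hamiltonianConstraintFn_comap`, `momentumConstraintFn_comap_apply`,
  `hamiltonianConstraintFn_homothety`, `momentumConstraintFn_homothety`; Bartnik–Isenberg 2004 §2);
* the annulus formula with mass `l μ` on `{l < ‖y‖ < 2 l}` and the exterior sheet
  Schwarzschild(`l M`) beyond `l M/2`: the scalar bookkeeping `m/(2‖y/l‖) = l m/(2‖y‖)`.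
This is the proof of the collar line's landed `stub_collarDilationB`
(`SwallowTheDatumParametricKerrBurialStubCollarDilationB.lean`) with the Kerr shield dropped.
References: Bartnik–Isenberg 2004 §2; Misner–Thorne–Wheeler 1973 (31.22); the skeleton
`Cruxes/UniversalWitnessFamily/Lines/Sketch.lean`.
-/

-- `Summit.<Summit>.<Problem>` is the tree's mandated summit-side namespace (CONVENTIONS §2); for this
-- single-conjunct summit the two coincide, so the duplicate is deliberate.
set_option linter.dupNamespace false

noncomputable section

-- instance search through the nested operator types `E3 →L E3 →L ℝ` (as in `ConstraintFamilies`)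
set_option maxSynthPendingDepth 3

namespace Summit.FinalStateConjecture.FinalStateConjecture.Theorems.SwallowTheDatum.UniversalWitnessFamily

open scoped Manifold ContDiff Topology
open Bundle Set Filter Function Literature.Geometry.Lorentzian
open Summit.FinalStateConjecture.FinalStateConjecture.Theorems.SwallowTheDatum.ParametricKerrBurial
  (SmoothSectionsOn AgreeAt IsExactSchwarzschildBeyond IsSchwarzschildAnnulus VacuumOn IsIsotropicBeyond)

/-! ## The stub -/

/-- **Stub `stub_socketDilation`: the dilates of a socket bag are socket bags.** From a socket bag
`C` — vacuum outside the unit ball, isotropic Schwarzschild(`μ`) with `k = 0` on `{1 < ‖y‖ < 2}`,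
exactly isotropic Schwarzschild(`M`) with `k = 0` beyond `M/2`, `M > 4` — the dilates
`C_l = ((y ↦ y/l)^* C).homothety l` (`h_l(y) = h(y/l)`, `k_l(y) = l⁻¹ k(y/l)`, junk `C` for `l ≤ 0`)
form a family with sections jointly smooth on `{0 < l} × E3` whose members are socket bags at scale
`l`: vacuum outside the ball of radius `l` (equivariance and homothety covariance of the
constraints, Bartnik–Isenberg 2004 §2), the annulus formula with mass `l μ` on `{l < ‖y‖ < 2l}`, and
exactly isotropic Schwarzschild(`l M`) beyond `l M/2`. [cite: BartnikIsenberg2004, §2] -/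
theorem stub_socketDilation :
  ∀ (C : InitialDataSet (𝓡 3) E3) (μ M : ℝ), 0 < μ → 4 < M →
    VacuumOn {y : E3 | 1 < ‖y‖} C → IsSchwarzschildAnnulus C μ → IsIsotropicBeyond M (M / 2) C →
    ∃ Cfam : ℝ → InitialDataSet (𝓡 3) E3,
      SmoothSectionsOn 𝓘(ℝ, ℝ) Cfam {p : ℝ × E3 | 0 < p.1} ∧
      ∀ l : ℝ, 0 < l →
        VacuumOn {y : E3 | l < ‖y‖} (Cfam l) ∧
        (∀ y : E3, l < ‖y‖ → ‖y‖ < 2 * l →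
          (Cfam l).h.inner y = (1 + l * μ / (2 * ‖y‖)) ^ 4 • (innerSL ℝ : E3 →L[ℝ] E3 →L[ℝ] ℝ) ∧
            (Cfam l).k y = 0) ∧
        IsIsotropicBeyond (l * M) (l * M / 2) (Cfam l) := by
  intro C μ M _ _ hvac hann hiso
  -- the Cartesian components of the dilates (`InitialDataDilation.lean`)
  have hhE : ∀ (l : ℝ) (hl : 0 < l) (x : E3),
      ((C.dilate l hl).h.inner x : E3 →L[ℝ] E3 →L[ℝ] ℝ) = C.h.inner (l⁻¹ • x) := fun l hl x ↦ by
    ext v w; exact C.dilate_h_inner l hl x v w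
  have hkE : ∀ (l : ℝ) (hl : 0 < l) (x : E3),
      ((C.dilate l hl).k x : E3 →L[ℝ] E3 →L[ℝ] ℝ) = l⁻¹ • C.k (l⁻¹ • x) := fun l hl x ↦ by
    ext v w; exact C.dilate_k l hl x v w
  -- the scalar bookkeeping `m/(2‖x/l‖) = l m/(2‖x‖)` (both sides vanish at `x = 0`)
  have hnorm : ∀ (l : ℝ), 0 < l → ∀ x : E3, ‖l⁻¹ • x‖ = l⁻¹ * ‖x‖ := fun l hl x ↦ by
    rw [norm_smul, Real.norm_eq_abs, abs_of_pos (inv_pos.2 hl)]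
  have hfrac : ∀ (l : ℝ), 0 < l → ∀ (m : ℝ) (x : E3),
      m / (2 * ‖l⁻¹ • x‖) = l * m / (2 * ‖x‖) := fun l hl m x ↦ by
    rcases eq_or_ne x 0 with rfl | hx
    · simp
    · have hx' : ‖x‖ ≠ 0 := norm_ne_zero_iff.2 hx
      rw [hnorm l hl]
      field_simp
  refine ⟨C.dilateFamily, ⟨fun p hp ↦ (C.contMDiffAt_dilateFamily_h hp).contMDiffWithinAt,
    fun p hp ↦ (C.contMDiffAt_dilateFamily_k hp).contMDiffWithinAt⟩, fun l hl ↦ ⟨?_, ?_, ?_⟩⟩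
  · -- vacuum outside the ball of radius `l`
    rw [C.dilateFamily_of_pos hl]
    intro inst y hy
    haveI hC' : C.metric.HasLeviCivita := C.metric.hasLeviCivita
    haveI hCc : (C.comap (InitialDataSet.shrinkCLM l) (InitialDataSet.contMDiff_shrinkCLM l)
        (InitialDataSet.injective_mfderiv_shrinkCLM hl.ne')).metric.HasLeviCivita :=
      (C.comap (InitialDataSet.shrinkCLM l) (InitialDataSet.contMDiff_shrinkCLM l)
        (InitialDataSet.injective_mfderiv_shrinkCLM hl.ne')).metric.hasLeviCivita
    haveI : ((C.comap (InitialDataSet.shrinkCLM l) (InitialDataSet.contMDiff_shrinkCLM l)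
        (InitialDataSet.injective_mfderiv_shrinkCLM hl.ne')).homothety l hl).metric.HasLeviCivita :=
      inst
    have hy' : InitialDataSet.shrinkCLM l y ∈ {y : E3 | 1 < ‖y‖} := by
      show 1 < ‖l⁻¹ • y‖
      rw [hnorm l hl, lt_inv_mul_iff₀ hl, mul_one]
      exact hy
    obtain ⟨hH, hM⟩ := hvac (InitialDataSet.shrinkCLM l y) hy'
    change ((C.comap (InitialDataSet.shrinkCLM l) (InitialDataSet.contMDiff_shrinkCLM l)
        (InitialDataSet.injective_mfderiv_shrinkCLM hl.ne')).homothety l hl).hamiltonianConstraintFn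
          y = 0 ∧
      ((C.comap (InitialDataSet.shrinkCLM l) (InitialDataSet.contMDiff_shrinkCLM l)
        (InitialDataSet.injective_mfderiv_shrinkCLM hl.ne')).homothety l hl).momentumConstraintFn
          y = 0
    refine ⟨?_, ?_⟩
    · rw [InitialDataSet.hamiltonianConstraintFn_homothety,
        InitialDataSet.hamiltonianConstraintFn_comap C (InitialDataSet.contMDiff_shrinkCLM l)
          (InitialDataSet.injective_mfderiv_shrinkCLM hl.ne') rfl, hH, mul_zero]
    · rw [InitialDataSet.momentumConstraintFn_homothety]
      refine smul_eq_zero_of_right _ (LinearMap.ext fun Y₀ ↦ ?_)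
      rw [InitialDataSet.momentumConstraintFn_comap_apply C (InitialDataSet.contMDiff_shrinkCLM l)
        (InitialDataSet.injective_mfderiv_shrinkCLM hl.ne') rfl y (C.mdifferentiableAt_traceK _),
        hM]
      rfl
  · -- the annulus formula at scale `l`
    intro y hy1 hy2
    have hy1' : 1 < ‖l⁻¹ • y‖ := by
      rw [hnorm l hl, lt_inv_mul_iff₀ hl, mul_one]; exact hy1
    have hy2' : ‖l⁻¹ • y‖ < 2 := by
      rw [hnorm l hl, inv_mul_lt_iff₀ hl]; linarith
    obtain ⟨h1, h2⟩ := hann (l⁻¹ • y) hy1' hy2'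
    rw [C.dilateFamily_of_pos hl]
    refine ⟨?_, ?_⟩
    · rw [hhE l hl y, h1, hfrac l hl μ y]
      rfl
    · rw [hkE l hl y, h2, smul_zero]
      rfl
  · -- the exterior sheet Schwarzschild(`l M`) beyond `l M/2`
    intro y hy
    have hy' : M / 2 < ‖l⁻¹ • y‖ := by
      rw [hnorm l hl, lt_inv_mul_iff₀ hl, ← mul_div_assoc]; exact hy
    obtain ⟨h1, h2⟩ := hiso (l⁻¹ • y) hy'
    rw [C.dilateFamily_of_pos hl]
    refine ⟨?_, ?_⟩
    · rw [hhE l hl y, h1, hfrac l hl M y]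
      rfl
    · rw [hkE l hl y, h2, smul_zero]
      rfl

end Summit.FinalStateConjecture.FinalStateConjecture.Theorems.SwallowTheDatum.UniversalWitnessFamily

end
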